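import Literature.NumberTheory.LFunctions.PrimeNumberTheoremErrorTermProofs
import Mathlib.NumberTheory.PrimeCounting
import Mathlib.Analysis.SpecialFunctions.Pow.Deriv
import Mathlib.Analysis.SpecialFunctions.Integrals.Basic
import Mathlib.MeasureTheory.Integral.Bochner.Set
import Mathlib.Order.Interval.Set.OrdConnected
import HarnessLib

/-!
# Prime sums against Lipschitz test functions in logarithmic scale (one prime variable)

Arithmetic input for the construction half (Theorem 6.3 (a)) of K. Ford, J. Maynard, *On the
theory of prime producing sieves* (arXiv:2407.14368): sums over primes `q ≤ x` of
`φ(log q / log x)` are Lebesgue integrals `∫ φ(y) x^y dy/y` up to `O_A((K+M) x^b (log x)^{-A})`,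
uniformly over all test functions `φ` that are `K`-Lipschitz on an interval `I ⊆ [η', 1]`,
bounded by `M`, and vanish outside `I` (`b = sup I`). This is the one-variable case of
Ford–Maynard's Lemma 5.11 ("sums over vectors of primes to multiple integrals"), with the prime
number theorem in the de la Vallée Poussin form `ϑ(x) = x + O_A(x (log x)^{-A})` (PROVED in the
tree, `ChebyshevThetaDeLaValleePoussin_holds.logPow`) in place of Huxley's theorem, hence with a
log-power instead of an `exp(-(log x)^{1/5})` saving — which is all that (I) requires. Everything
here is PROVED; the several-variables statement is obtained from this one by induction in
`FordMaynardPrimeSumsTuples.lean`.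

* `FordMaynard.sum_primesLE_log_filter_eq` — `∑_{x^α < q ≤ x^β} log q = ϑ(x^β) − ϑ(x^α)`;
* `FordMaynard.primeLogSum_piece_approx` — one short piece `(α, β]` of the comparison;
* `FordMaynard.exists_primeLogSum_approx` — the `ϑ`-weighted comparison
  `|∑_q (log q) φ(y_q) − (log x) ∫ φ(y) x^y dy| ≤ C (K+M) x^b/(log x)^A`;
* `FordMaynard.exists_primeSum_approx` — the unweighted comparison
  `|∑_q φ(y_q) − ∫ φ(y) x^y/y dy| ≤ C (K+M) x^b/(log x)^A` (main export).

## References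

* K. Ford, J. Maynard, *On the theory of prime producing sieves*, arXiv:2407.14368v1 (2024), §5.5
  Lemmas 5.10–5.11 and §6.2 (proof of Theorem 6.3 (a), (construction-TypeI)).
  [FordMaynard2024PrimeSieves]
* H. L. Montgomery, R. C. Vaughan, *Multiplicative Number Theory I*, CUP 2007, Theorem 6.9.
  [MontgomeryVaughan2007]
-/

noncomputable section

open MeasureTheory Finset Real
open scoped Chebyshev

namespace Literature.NumberTheory.Sieve.FordMaynard

/-! ### Primes in logarithmic scale -/

/-- For `x > 1` and a natural number `q ≥ 1`: `q ≤ x^u ↔ log q / log x ≤ u`. [folklore] -/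
theorem natCast_le_rpow_iff {x : ℝ} (hx : 1 < x) {q : ℕ} (hq : 1 ≤ q) (u : ℝ) :
    (q : ℝ) ≤ x ^ u ↔ Real.log q / Real.log x ≤ u := by
  have hx0 : 0 < x := by linarith
  have hlx : 0 < Real.log x := Real.log_pos hx
  have hq0 : (0 : ℝ) < q := by exact_mod_cast hq
  rw [div_le_iff₀ hlx, ← Real.log_rpow hx0, Real.log_le_log_iff hq0 (Real.rpow_pos_of_pos hx0 u)]

/-- For `x > 1` and a natural number `q ≥ 1`: `x^u < q ↔ u < log q / log x`. [folklore] -/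
theorem rpow_lt_natCast_iff {x : ℝ} (hx : 1 < x) {q : ℕ} (hq : 1 ≤ q) (u : ℝ) :
    x ^ u < (q : ℝ) ↔ u < Real.log q / Real.log x := by
  rw [← not_le, natCast_le_rpow_iff hx hq, not_le]

/-- The primes `q ≤ x` with `log q / log x ≤ β` (`β ≤ 1`, `x > 1`) are the primes `q ≤ x^β`.
[folklore] -/
theorem primesLE_filter_le_eq {x : ℝ} (hx : 1 < x) {β : ℝ} (hβ : β ≤ 1) :
    (Nat.primesLE ⌊x⌋₊).filter (fun q : ℕ => Real.log q / Real.log x ≤ β) = Nat.primesLE ⌊x ^ β⌋₊ := by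
  have hx0 : 0 < x := by linarith
  ext q
  simp only [Finset.mem_filter, Nat.mem_primesLE]
  constructor
  · rintro ⟨⟨-, hp⟩, hle⟩
    refine ⟨?_, hp⟩
    rw [Nat.le_floor_iff (Real.rpow_nonneg hx0.le β)]
    exact (natCast_le_rpow_iff hx hp.one_lt.le β).2 hle
  · rintro ⟨hq, hp⟩
    have hqx : (q : ℝ) ≤ x ^ β :=
      (Nat.le_floor_iff (Real.rpow_nonneg hx0.le β)).1 hq
    refine ⟨⟨?_, hp⟩, (natCast_le_rpow_iff hx hp.one_lt.le β).1 hqx⟩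
    rw [Nat.le_floor_iff hx0.le]
    refine hqx.trans ?_
    calc x ^ β ≤ x ^ (1 : ℝ) := Real.rpow_le_rpow_of_exponent_le hx.le hβ
      _ = x := Real.rpow_one x
  
/-- `∑_{q ≤ x, log q/log x ≤ β} log q = ϑ(x^β)` for `β ≤ 1 < x`. [folklore] -/
theorem sum_primesLE_log_filter_le_eq {x : ℝ} (hx : 1 < x) {β : ℝ} (hβ : β ≤ 1) :
    ∑ q ∈ (Nat.primesLE ⌊x⌋₊).filter (fun q : ℕ => Real.log q / Real.log x ≤ β), Real.log q =
      θ (x ^ β) := by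
  rw [primesLE_filter_le_eq hx hβ, Chebyshev.theta_eq_sum_primesLE]

/-- **Prime log sums over a logarithmic piece**: for `α ≤ β ≤ 1 < x`,
`∑_{q ≤ x prime, α < log q/log x ≤ β} log q = ϑ(x^β) − ϑ(x^α)`. [folklore] -/
theorem sum_primesLE_log_filter_eq {x : ℝ} (hx : 1 < x) {α β : ℝ} (hαβ : α ≤ β) (hβ : β ≤ 1) :
    ∑ q ∈ (Nat.primesLE ⌊x⌋₊).filter
        (fun q : ℕ => α < Real.log q / Real.log x ∧ Real.log q / Real.log x ≤ β), Real.log q =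
      θ (x ^ β) - θ (x ^ α) := by
  rw [← sum_primesLE_log_filter_le_eq hx hβ, ← sum_primesLE_log_filter_le_eq hx (hαβ.trans hβ)]
  rw [eq_sub_iff_add_eq, ← Finset.sum_union]
  · congr 1
    ext q
    simp only [Finset.mem_union, Finset.mem_filter]
    constructor
    · rintro (⟨hq, h1, h2⟩ | ⟨hq, h1⟩)
      · exact ⟨hq, h2⟩
      · exact ⟨hq, h1.trans hαβ⟩
    · rintro ⟨hq, h⟩
      by_cases hα : Real.log q / Real.log x ≤ α
      · exact Or.inr ⟨hq, hα⟩
      · exact Or.inl ⟨hq, not_le.1 hα, h⟩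
  · rw [Finset.disjoint_filter]
    intro q _ h1 h2
    exact absurd h2 (not_le.2 h1.1)

/-- At most one prime `q ≤ x` has a prescribed value of `log q / log x` (`x > 1`). [folklore] -/
theorem card_primesLE_filter_eq_le_one {x : ℝ} (hx : 1 < x) (c : ℝ) :
    ((Nat.primesLE ⌊x⌋₊).filter (fun q : ℕ => Real.log q / Real.log x = c)).card ≤ 1 := by
  have hlx : 0 < Real.log x := Real.log_pos hx
  rw [Finset.card_le_one]
  intro p hp q hq
  simp only [Finset.mem_filter, Nat.mem_primesLE] at hp hq
  have hp0 : (0 : ℝ) < p := by exact_mod_cast hp.1.2.pos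
  have hq0 : (0 : ℝ) < q := by exact_mod_cast hq.1.2.pos
  have h : Real.log p = Real.log q := by
    have h1 := hp.2; have h2 := hq.2
    rw [div_eq_iff hlx.ne'] at h1 h2
    rw [h1, h2]
  exact_mod_cast Real.log_injOn_pos hp0 hq0 h

/-- A sum of `log q` over at most the primes `q ≤ x` with a prescribed `log q/log x` is at most
`log x`. [folklore] -/
theorem sum_log_filter_eq_le {x : ℝ} (hx : 1 < x) (c : ℝ) (s : Finset ℕ)
    (hs : s ⊆ Nat.primesLE ⌊x⌋₊) :
    ∑ q ∈ s.filter (fun q : ℕ => Real.log q / Real.log x = c), Real.log q ≤ Real.log x := by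
  have hx0 : 0 < x := by linarith
  have hsub : s.filter (fun q : ℕ => Real.log q / Real.log x = c) ⊆
      (Nat.primesLE ⌊x⌋₊).filter (fun q : ℕ => Real.log q / Real.log x = c) :=
    Finset.filter_subset_filter _ hs
  have hle : ∀ q ∈ (Nat.primesLE ⌊x⌋₊).filter (fun q : ℕ => Real.log q / Real.log x = c),
      Real.log q ≤ Real.log x := by
    intro q hq
    simp only [Finset.mem_filter, Nat.mem_primesLE] at hq
    have hq1 : (0 : ℝ) < q := by exact_mod_cast hq.1.2.pos
    exact Real.log_le_log hq1 ((Nat.cast_le.2 hq.1.1).trans (Nat.floor_le hx0.le))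
  have hnn : ∀ q ∈ (Nat.primesLE ⌊x⌋₊).filter (fun q : ℕ => Real.log q / Real.log x = c),
      0 ≤ Real.log q := by
    intro q hq
    simp only [Finset.mem_filter, Nat.mem_primesLE] at hq
    exact Real.log_nonneg (by exact_mod_cast hq.1.2.one_lt.le)
  calc ∑ q ∈ s.filter (fun q : ℕ => Real.log q / Real.log x = c), Real.log q
      ≤ ∑ q ∈ (Nat.primesLE ⌊x⌋₊).filter (fun q : ℕ => Real.log q / Real.log x = c), Real.log q :=
        Finset.sum_le_sum_of_subset_of_nonneg hsub (fun q hq _ => hnn q hq)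
    _ ≤ ∑ _q ∈ (Nat.primesLE ⌊x⌋₊).filter (fun q : ℕ => Real.log q / Real.log x = c), Real.log x :=
        Finset.sum_le_sum hle
    _ = ((Nat.primesLE ⌊x⌋₊).filter (fun q : ℕ => Real.log q / Real.log x = c)).card * Real.log x := by
        rw [Finset.sum_const, nsmul_eq_mul]
    _ ≤ 1 * Real.log x := by
        refine mul_le_mul_of_nonneg_right ?_ (Real.log_nonneg hx.le)
        exact_mod_cast card_primesLE_filter_eq_le_one hx c
    _ = Real.log x := one_mul _

/-! ### The integral of `x^y` -/

/-- `(log x) ∫_α^β x^y dy = x^β − x^α` for `x > 0`. [folklore] -/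
theorem log_mul_integral_rpow {x : ℝ} (hx : 0 < x) (α β : ℝ) :
    Real.log x * ∫ y in α..β, x ^ y = x ^ β - x ^ α := by
  have hderiv : ∀ y ∈ Set.uIcc α β, HasDerivAt (fun y : ℝ => x ^ y) (x ^ y * Real.log x) y :=
    fun y _ => (Real.hasStrictDerivAt_const_rpow hx y).hasDerivAt
  have hcont : Continuous fun y : ℝ => x ^ y * Real.log x :=
    (Real.continuous_const_rpow hx.ne').mul continuous_const
  have h := intervalIntegral.integral_eq_sub_of_hasDerivAt hderiv (hcont.intervalIntegrable _ _)
  rw [intervalIntegral.integral_mul_const] at h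
  rw [mul_comm]
  exact h

/-- A measurable function bounded on `[α, β]` is interval integrable there. [folklore] -/
theorem intervalIntegrable_of_abs_le {f : ℝ → ℝ} (hf : Measurable f) {α β B : ℝ} (hαβ : α ≤ β)
    (hB : ∀ y ∈ Set.Icc α β, |f y| ≤ B) : IntervalIntegrable f volume α β := by
  rw [intervalIntegrable_iff_integrableOn_Ioc_of_le hαβ]
  refine Integrable.mono' (g := fun _ => B) ?_ hf.aestronglyMeasurable ?_
  · exact integrableOn_const (by simp)
  · filter_upwards [ae_restrict_mem measurableSet_Ioc] with y hy
    rw [Real.norm_eq_abs]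
    exact hB y (Set.Ioc_subset_Icc_self hy)

/-- Splitting a filtered sum over `α < f ≤ γ` at `β ∈ [α, γ]`. [folklore] -/
theorem sum_filter_Ioc_split {ι : Type*} [DecidableEq ι] (s : Finset ι) (f : ι → ℝ) (F : ι → ℝ) {α β γ : ℝ}
    (hαβ : α ≤ β) (hβγ : β ≤ γ) :
    ∑ i ∈ s.filter (fun i => α < f i ∧ f i ≤ γ), F i =
      ∑ i ∈ s.filter (fun i => α < f i ∧ f i ≤ β), F i +
        ∑ i ∈ s.filter (fun i => β < f i ∧ f i ≤ γ), F i := by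
  rw [← Finset.sum_union]
  · congr 1
    ext i
    simp only [Finset.mem_union, Finset.mem_filter]
    constructor
    · rintro ⟨hi, h1, h2⟩
      by_cases hb : f i ≤ β
      · exact Or.inl ⟨hi, h1, hb⟩
      · exact Or.inr ⟨hi, not_le.1 hb, h2⟩
    · rintro (⟨hi, h1, h2⟩ | ⟨hi, h1, h2⟩)
      · exact ⟨hi, h1, h2.trans hβγ⟩
      · exact ⟨hi, lt_of_le_of_lt hαβ h1, h2⟩
  · rw [Finset.disjoint_filter]
    intro i _ h1 h2
    exact absurd h1.2 (not_le.2 h2.1)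

/-! ### One piece of the comparison -/

/-- **One piece.** For `α ≤ β ≤ 1 < x`, a test function `φ` that is `K`-Lipschitz on a set
`I` containing every `y ∈ (α, β]` except possibly one point `y = b`, bounded by `M`, and a base point
`c ∈ I` within `δ` of every point of `(α, β]`:
`|∑_{α < y_q ≤ β} (log q) φ(y_q) − (log x) ∫_α^β φ(y) x^y dy|`
`≤ M(|ϑ(x^β) − x^β| + |ϑ(x^α) − x^α|) + Kδ(ϑ(x^β) − ϑ(x^α)) + 2M log x + Kδ(x^β − x^α)`
(`y_q = log q/log x`; the term `2M log x` accounts for the at most one prime with `y_q = b`).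
[cite: FordMaynard2024PrimeSieves, Lemma 5.11 (proof)] -/
theorem primeLogSum_piece_approx {x : ℝ} (hx : 1 < x) {I : Set ℝ} {φ : ℝ → ℝ} {K M δ : ℝ}
    (hK : 0 ≤ K) (hM : 0 ≤ M) (hδ : 0 ≤ δ) (hφm : Measurable φ)
    (hlip : ∀ y ∈ I, ∀ y' ∈ I, |φ y - φ y'| ≤ K * |y - y'|) (hbd : ∀ y, |φ y| ≤ M)
    {α β b c : ℝ} (hαβ : α ≤ β) (hβ1 : β ≤ 1)
    (hI : ∀ y, α < y → y ≤ β → y ≠ b → y ∈ I) (hc : c ∈ I)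
    (hcδ : ∀ y, α < y → y ≤ β → |y - c| ≤ δ) :
    |(∑ q ∈ (Nat.primesLE ⌊x⌋₊).filter
          (fun q : ℕ => α < Real.log q / Real.log x ∧ Real.log q / Real.log x ≤ β),
          Real.log q * φ (Real.log q / Real.log x)) -
        Real.log x * ∫ y in α..β, φ y * x ^ y| ≤
      M * (|θ (x ^ β) - x ^ β| + |θ (x ^ α) - x ^ α|) + K * δ * (θ (x ^ β) - θ (x ^ α)) +
        2 * M * Real.log x + K * δ * (x ^ β - x ^ α) := by
  have hx0 : 0 < x := by linarith
  have hlx : 0 < Real.log x := Real.log_pos hx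
  set P : Finset ℕ := (Nat.primesLE ⌊x⌋₊).filter
    (fun q : ℕ => α < Real.log q / Real.log x ∧ Real.log q / Real.log x ≤ β) with hP
  set yq : ℕ → ℝ := fun q => Real.log q / Real.log x with hyq
  have hS : ∑ q ∈ P, Real.log q = θ (x ^ β) - θ (x ^ α) := sum_primesLE_log_filter_eq hx hαβ hβ1
  have hlog0 : ∀ q ∈ P, 0 ≤ Real.log q := by
    intro q hq
    simp only [hP, Finset.mem_filter, Nat.mem_primesLE] at hq
    exact Real.log_nonneg (by exact_mod_cast hq.1.2.one_lt.le)
  -- the integral of the constant `φ c`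
  have hIc : Real.log x * ∫ y in α..β, φ c * x ^ y = φ c * (x ^ β - x ^ α) := by
    rw [intervalIntegral.integral_const_mul, ← mul_assoc, mul_comm (Real.log x), mul_assoc,
      log_mul_integral_rpow hx0]
  -- integrability
  have hint1 : IntervalIntegrable (fun y => φ y * x ^ y) volume α β := by
    refine intervalIntegrable_of_abs_le (f := fun y => φ y * x ^ y)
      (hφm.mul (Real.continuous_const_rpow hx0.ne').measurable) hαβ
      (B := M * x ^ β) fun y hy => ?_
    show |φ y * x ^ y| ≤ M * x ^ β
    rw [abs_mul, abs_of_pos (Real.rpow_pos_of_pos hx0 y)]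
    exact mul_le_mul (hbd y) (Real.rpow_le_rpow_of_exponent_le hx.le hy.2)
      (Real.rpow_nonneg hx0.le _) hM
  have hint2 : IntervalIntegrable (fun y => φ c * x ^ y) volume α β :=
    ((Real.continuous_const_rpow hx0.ne').continuousOn.intervalIntegrable).const_mul _
  have hint3 : IntervalIntegrable (fun y => K * δ * x ^ y) volume α β :=
    ((Real.continuous_const_rpow hx0.ne').continuousOn.intervalIntegrable).const_mul _
  -- decomposition of the difference
  have hdecomp : (∑ q ∈ P, Real.log q * φ (yq q)) - Real.log x * ∫ y in α..β, φ y * x ^ y =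
      φ c * ((θ (x ^ β) - x ^ β) - (θ (x ^ α) - x ^ α)) +
        (∑ q ∈ P, Real.log q * (φ (yq q) - φ c)) -
        Real.log x * ∫ y in α..β, (φ y - φ c) * x ^ y := by
    have h1 : ∫ y in α..β, (φ y - φ c) * x ^ y =
        (∫ y in α..β, φ y * x ^ y) - ∫ y in α..β, φ c * x ^ y := by
      rw [← intervalIntegral.integral_sub hint1 hint2]
      congr 1; funext y; ring
    have h2 : ∑ q ∈ P, Real.log q * (φ (yq q) - φ c) =
        (∑ q ∈ P, Real.log q * φ (yq q)) - φ c * ∑ q ∈ P, Real.log q := by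
      rw [Finset.mul_sum, ← Finset.sum_sub_distrib]
      refine Finset.sum_congr rfl fun q _ => ?_; ring
    rw [h1, h2, hS]
    linear_combination -hIc
  -- bound for the first term
  have hT1 : |φ c * ((θ (x ^ β) - x ^ β) - (θ (x ^ α) - x ^ α))| ≤
      M * (|θ (x ^ β) - x ^ β| + |θ (x ^ α) - x ^ α|) := by
    rw [abs_mul]
    exact mul_le_mul (hbd c) (abs_sub _ _) (abs_nonneg _) hM
  -- bound for the second term
  have hT2 : |∑ q ∈ P, Real.log q * (φ (yq q) - φ c)| ≤
      K * δ * (θ (x ^ β) - θ (x ^ α)) + 2 * M * Real.log x := by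
    have hsplit : ∑ q ∈ P, Real.log q * (φ (yq q) - φ c) =
        (∑ q ∈ P.filter (fun q : ℕ => yq q = b), Real.log q * (φ (yq q) - φ c)) +
          ∑ q ∈ P.filter (fun q : ℕ => ¬ yq q = b), Real.log q * (φ (yq q) - φ c) :=
      (Finset.sum_filter_add_sum_filter_not P (fun q : ℕ => yq q = b) _).symm
    rw [hsplit]
    refine (abs_add_le _ _).trans ?_
    rw [add_comm]
    refine add_le_add ?_ ?_
    · -- the primes with `y_q ≠ b`
      calc |∑ q ∈ P.filter (fun q : ℕ => ¬ yq q = b), Real.log q * (φ (yq q) - φ c)|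
          ≤ ∑ q ∈ P.filter (fun q : ℕ => ¬ yq q = b), |Real.log q * (φ (yq q) - φ c)| :=
            Finset.abs_sum_le_sum_abs _ _
        _ ≤ ∑ q ∈ P.filter (fun q : ℕ => ¬ yq q = b), Real.log q * (K * δ) := by
            refine Finset.sum_le_sum fun q hq => ?_
            rw [Finset.mem_filter] at hq
            have hqP := hq.1
            simp only [hP, Finset.mem_filter] at hqP
            rw [abs_mul, abs_of_nonneg (hlog0 q hq.1)]
            refine mul_le_mul_of_nonneg_left ?_ (hlog0 q hq.1)
            have hyI : yq q ∈ I := hI _ hqP.2.1 hqP.2.2 hq.2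
            calc |φ (yq q) - φ c| ≤ K * |yq q - c| := hlip _ hyI _ hc
              _ ≤ K * δ := mul_le_mul_of_nonneg_left (hcδ _ hqP.2.1 hqP.2.2) hK
        _ = K * δ * ∑ q ∈ P.filter (fun q : ℕ => ¬ yq q = b), Real.log q := by
            rw [Finset.mul_sum]; refine Finset.sum_congr rfl fun q _ => ?_; ring
        _ ≤ K * δ * (θ (x ^ β) - θ (x ^ α)) := by
            refine mul_le_mul_of_nonneg_left ?_ (mul_nonneg hK hδ)
            rw [← hS]
            exact Finset.sum_le_sum_of_subset_of_nonneg (Finset.filter_subset _ _)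
              (fun q hq _ => hlog0 q hq)
    · -- the (at most one) prime with `y_q = b`
      calc |∑ q ∈ P.filter (fun q : ℕ => yq q = b), Real.log q * (φ (yq q) - φ c)|
          ≤ ∑ q ∈ P.filter (fun q : ℕ => yq q = b), |Real.log q * (φ (yq q) - φ c)| :=
            Finset.abs_sum_le_sum_abs _ _
        _ ≤ ∑ q ∈ P.filter (fun q : ℕ => yq q = b), Real.log q * (2 * M) := by
            refine Finset.sum_le_sum fun q hq => ?_
            rw [Finset.mem_filter] at hq
            rw [abs_mul, abs_of_nonneg (hlog0 q hq.1)]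
            refine mul_le_mul_of_nonneg_left ?_ (hlog0 q hq.1)
            calc |φ (yq q) - φ c| ≤ |φ (yq q)| + |φ c| := abs_sub _ _
              _ ≤ M + M := add_le_add (hbd _) (hbd _)
              _ = 2 * M := by ring
        _ = 2 * M * ∑ q ∈ P.filter (fun q : ℕ => yq q = b), Real.log q := by
            rw [Finset.mul_sum]; refine Finset.sum_congr rfl fun q _ => ?_; ring
        _ ≤ 2 * M * Real.log x := by
            refine mul_le_mul_of_nonneg_left ?_ (by positivity)
            exact sum_log_filter_eq_le hx b P (Finset.filter_subset _ _)
  -- bound for the third term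
  have hT3 : |Real.log x * ∫ y in α..β, (φ y - φ c) * x ^ y| ≤ K * δ * (x ^ β - x ^ α) := by
    rw [abs_mul, abs_of_pos hlx]
    have hae : ∀ᵐ y ∂volume, y ∈ Set.Ioc α β → ‖(φ y - φ c) * x ^ y‖ ≤ K * δ * x ^ y := by
      have hne : ∀ᵐ y ∂(volume : Measure ℝ), y ≠ b := by
        rw [ae_iff]
        have : {a : ℝ | ¬a ≠ b} = {b} := by ext; simp
        rw [this, measure_singleton]
      filter_upwards [hne] with y hyb hy
      rw [Real.norm_eq_abs, abs_mul, abs_of_pos (Real.rpow_pos_of_pos hx0 y)]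
      refine mul_le_mul_of_nonneg_right ?_ (Real.rpow_nonneg hx0.le _)
      have hyI : y ∈ I := hI y hy.1 hy.2 hyb
      calc |φ y - φ c| ≤ K * |y - c| := hlip _ hyI _ hc
        _ ≤ K * δ := mul_le_mul_of_nonneg_left (hcδ _ hy.1 hy.2) hK
    have h := intervalIntegral.norm_integral_le_of_norm_le hαβ hae hint3
    rw [Real.norm_eq_abs] at h
    have hI3 : ∫ y in α..β, K * δ * x ^ y = K * δ * ∫ y in α..β, x ^ y :=
      intervalIntegral.integral_const_mul _ _
    rw [hI3] at h
    calc Real.log x * |∫ y in α..β, (φ y - φ c) * x ^ y|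
        ≤ Real.log x * (K * δ * ∫ y in α..β, x ^ y) := mul_le_mul_of_nonneg_left h hlx.le
      _ = K * δ * (Real.log x * ∫ y in α..β, x ^ y) := by ring
      _ = K * δ * (x ^ β - x ^ α) := by rw [log_mul_integral_rpow hx0]
  rw [hdecomp]
  have habs : ∀ u v w : ℝ, |u + v - w| ≤ |u| + |v| + |w| := by
    intro u v w
    calc |u + v - w| ≤ |u + v| + |w| := abs_sub _ _
      _ ≤ |u| + |v| + |w| := by linarith [abs_add_le u v]
  refine (habs _ _ _).trans ?_
  linarith [hT1, hT2, hT3]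

/-! ### Summing the pieces -/

/-- **All pieces** (induction on the number of pieces): with `δ = (b − a)/N` and
`a_n = a + nδ`, for `n ≤ N`,
`|∑_{a < y_q ≤ a_n} (log q) φ(y_q) − (log x)∫_a^{a_n} φ x^y dy|`
`≤ n (2M E + 2M log x) + Kδ((ϑ(x^{a_n}) + x^{a_n}) − (ϑ(x^a) + x^a))`,
where `E` bounds `|ϑ(x^u) − x^u|` on `[a, b]`. [cite: FordMaynard2024PrimeSieves, Lemma 5.11 (proof)] -/
theorem primeLogSum_pieces_approx {x : ℝ} (hx : 1 < x) {I : Set ℝ} {φ : ℝ → ℝ} {K M E : ℝ}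
    (hK : 0 ≤ K) (hM : 0 ≤ M) (hφm : Measurable φ)
    (hlip : ∀ y ∈ I, ∀ y' ∈ I, |φ y - φ y'| ≤ K * |y - y'|) (hbd : ∀ y, |φ y| ≤ M)
    {a b : ℝ} (hab : a ≤ b) (hb1 : b ≤ 1) (hne : I.Nonempty)
    (hIsub : ∀ y ∈ I, a ≤ y ∧ y ≤ b) (hIab : ∀ y, a < y → y < b → y ∈ I)
    (hE : ∀ u, a ≤ u → u ≤ b → |θ (x ^ u) - x ^ u| ≤ E) {N : ℕ} (hN : 1 ≤ N) (n : ℕ) (hn : n ≤ N) :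
    |(∑ q ∈ (Nat.primesLE ⌊x⌋₊).filter
          (fun q : ℕ => a < Real.log q / Real.log x ∧
            Real.log q / Real.log x ≤ a + n * ((b - a) / N)),
          Real.log q * φ (Real.log q / Real.log x)) -
        Real.log x * ∫ y in a..(a + n * ((b - a) / N)), φ y * x ^ y| ≤
      n * (2 * M * E + 2 * M * Real.log x) +
        K * ((b - a) / N) * ((θ (x ^ (a + n * ((b - a) / N))) + x ^ (a + n * ((b - a) / N))) -
          (θ (x ^ a) + x ^ a)) := by
  have hx0 : 0 < x := by linarith
  have hNpos : (0 : ℝ) < N := by exact_mod_cast hN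
  set δ : ℝ := (b - a) / N with hδ
  have hδ0 : 0 ≤ δ := div_nonneg (by linarith) hNpos.le
  have hNδ : a + N * δ = b := by rw [hδ]; field_simp; ring
  -- integrability on every subinterval
  have hint : ∀ α β : ℝ, α ≤ β → IntervalIntegrable (fun y => φ y * x ^ y) volume α β := by
    intro α β hαβ
    refine intervalIntegrable_of_abs_le (f := fun y => φ y * x ^ y)
      (hφm.mul (Real.continuous_const_rpow hx0.ne').measurable) hαβ
      (B := M * x ^ β) fun y hy => ?_
    show |φ y * x ^ y| ≤ M * x ^ β
    rw [abs_mul, abs_of_pos (Real.rpow_pos_of_pos hx0 y)]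
    exact mul_le_mul (hbd y) (Real.rpow_le_rpow_of_exponent_le hx.le hy.2)
      (Real.rpow_nonneg hx0.le _) hM
  induction n with
  | zero =>
    simp only [Nat.cast_zero, zero_mul, add_zero, intervalIntegral.integral_same, mul_zero,
      sub_zero, sub_self]
    rw [Finset.sum_eq_zero]
    · simp
    · intro q hq
      rw [Finset.mem_filter] at hq
      exact absurd hq.2.2 (not_le.2 hq.2.1)
  | succ n ih =>
    have hn' : n ≤ N := Nat.le_of_succ_le hn
    have ih' := ih hn'
    -- the new piece `(α', β']`
    set α' : ℝ := a + n * δ with hα'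
    set β' : ℝ := a + (n + 1 : ℕ) * δ with hβ'
    have hαβ' : α' ≤ β' := by
      rw [hα', hβ']; push_cast; nlinarith
    have hβ'eq : β' = α' + δ := by rw [hα', hβ']; push_cast; ring
    have haα' : a ≤ α' := by rw [hα']; nlinarith [hδ0]
    have hβ'b : β' ≤ b := by
      rw [← hNδ, hβ']
      have : ((n + 1 : ℕ) : ℝ) ≤ N := by exact_mod_cast hn
      nlinarith
    have hβ'1 : β' ≤ 1 := hβ'b.trans hb1
    -- the base point of the piece
    set c : ℝ := α' + δ / 2 with hc
    have hcI : c ∈ I := by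
      rcases eq_or_lt_of_le hab with hab' | hab'
      · -- `a = b`: then `δ = 0`, `c = a`, and `I = {a}`
        have hδz : δ = 0 := by rw [hδ, hab', sub_self, zero_div]
        have hca : c = a := by rw [hc, hα', hδz]; ring
        obtain ⟨y, hy⟩ := hne
        have hya : y = a := by
          have := hIsub y hy; rw [← hab'] at this; exact le_antisymm this.2 this.1
        rw [hca, ← hya]; exact hy
      · -- `a < b`: then `δ > 0` and `c ∈ (a, b)`
        have hδp : 0 < δ := div_pos (by linarith) hNpos
        refine hIab c ?_ ?_
        · rw [hc]; linarith
        · rw [hc]; linarith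
    have hcδ : ∀ y, α' < y → y ≤ β' → |y - c| ≤ δ := by
      intro y h1 h2
      rw [hβ'eq] at h2
      rw [hc, abs_le]; constructor <;> linarith
    have hIpiece : ∀ y, α' < y → y ≤ β' → y ≠ b → y ∈ I := by
      intro y h1 h2 h3
      exact hIab y (lt_of_le_of_lt haα' h1) (lt_of_le_of_ne (h2.trans hβ'b) h3)
    have hpiece := primeLogSum_piece_approx hx hK hM hδ0 hφm hlip hbd hαβ' hβ'1 hIpiece hcI hcδ
    -- splitting the sum and the integral
    have hsum := sum_filter_Ioc_split (Nat.primesLE ⌊x⌋₊)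
      (fun q : ℕ => Real.log q / Real.log x)
      (fun q : ℕ => Real.log q * φ (Real.log q / Real.log x)) haα' hαβ'
    have hintsplit : ∫ y in a..β', φ y * x ^ y =
        (∫ y in a..α', φ y * x ^ y) + ∫ y in α'..β', φ y * x ^ y :=
      (intervalIntegral.integral_add_adjacent_intervals (hint a α' haα') (hint α' β' hαβ')).symm
    have hEα := hE α' haα' (hαβ'.trans hβ'b)
    have hEβ := hE β' (haα'.trans hαβ') hβ'b
    -- monotonicity of `ϑ(x^u) + x^u`
    have hmono : θ (x ^ α') + x ^ α' ≤ θ (x ^ β') + x ^ β' :=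
      add_le_add (Chebyshev.theta_mono (Real.rpow_le_rpow_of_exponent_le hx.le hαβ'))
        (Real.rpow_le_rpow_of_exponent_le hx.le hαβ')
    rw [hsum, hintsplit, mul_add]
    have key : ∀ (S₁ S₂ I₁ I₂ : ℝ), |S₁ + S₂ - (I₁ + I₂)| ≤ |S₁ - I₁| + |S₂ - I₂| := by
      intro S₁ S₂ I₁ I₂
      calc |S₁ + S₂ - (I₁ + I₂)| = |(S₁ - I₁) + (S₂ - I₂)| := by ring_nf
        _ ≤ |S₁ - I₁| + |S₂ - I₂| := abs_add_le _ _
    refine (key _ _ _ _).trans ?_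
    have hcast : ((n + 1 : ℕ) : ℝ) = n + 1 := by push_cast; ring
    rw [hcast]
    have hθd : 0 ≤ θ (x ^ β') - θ (x ^ α') :=
      sub_nonneg.2 (Chebyshev.theta_mono (Real.rpow_le_rpow_of_exponent_le hx.le hαβ'))
    nlinarith [ih', hpiece, hEα, hEβ, hmono, mul_nonneg hK hδ0, abs_nonneg (θ (x ^ β') - x ^ β'),
      abs_nonneg (θ (x ^ α') - x ^ α'), hθd]

/-! ### The `ϑ`-weighted comparison -/

/-- The prime number theorem with a log-power error term, natural exponent (from the tree's
PROVED `ChebyshevThetaDeLaValleePoussin_holds`): `|ϑ(t) − t| ≤ C t/(log t)^n` for `t ≥ 2`.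
[cite: MontgomeryVaughan2007, Theorem 6.9 (6.13)] -/
theorem exists_abs_theta_sub_le_pow (n : ℕ) :
    ∃ C : ℝ, 0 ≤ C ∧ ∀ t : ℝ, 2 ≤ t → |θ t - t| ≤ C * t / Real.log t ^ n := by
  obtain ⟨C, hC⟩ :=
    Literature.NumberTheory.LFunctions.ChebyshevThetaDeLaValleePoussin_holds.logPow (n : ℝ)
  refine ⟨max C 0, le_max_right _ _, fun t ht => ?_⟩
  have h := hC t ht
  rw [Real.rpow_natCast] at h
  refine h.trans ?_
  have hl : 0 < Real.log t ^ n := pow_pos (Real.log_pos (by linarith)) n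
  exact div_le_div_of_nonneg_right (mul_le_mul_of_nonneg_right (le_max_left _ _) (by linarith))
    hl.le

/-- Eventually in `x`: `3 ≤ x`, `2 ≤ x^{η'}` and `(log x)^{2A+1} ≤ x^{η'}`. [folklore] -/
theorem eventually_largeX (η' : ℝ) (hη' : 0 < η') (A : ℕ) :
    ∃ X : ℝ, 2 ≤ X ∧ ∀ x : ℝ, X ≤ x →
      3 ≤ x ∧ 2 ≤ x ^ η' ∧ Real.log x ^ (2 * A + 1) ≤ x ^ η' := by
  have h1 : ∀ᶠ x : ℝ in Filter.atTop, 3 ≤ x := Filter.eventually_ge_atTop 3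
  have h2 : ∀ᶠ x : ℝ in Filter.atTop, 2 ≤ x ^ η' :=
    (tendsto_rpow_atTop hη').eventually_ge_atTop 2
  have h3 : ∀ᶠ x : ℝ in Filter.atTop, Real.log x ^ (2 * A + 1) ≤ x ^ η' := by
    have hlo := isLittleO_log_rpow_rpow_atTop ((2 * A + 1 : ℕ) : ℝ) hη'
    filter_upwards [hlo.bound (by norm_num : (0 : ℝ) < 1), Filter.eventually_ge_atTop (1 : ℝ)]
      with x hx hx1
    rw [one_mul, Real.norm_eq_abs, Real.norm_eq_abs, Real.rpow_natCast] at hx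
    rw [abs_of_nonneg (pow_nonneg (Real.log_nonneg hx1) _),
      abs_of_nonneg (Real.rpow_nonneg (by linarith) _)] at hx
    exact hx
  obtain ⟨X, hX⟩ := Filter.eventually_atTop.1 (h1.and (h2.and h3))
  refine ⟨max X 2, le_max_right _ _, fun x hx => ?_⟩
  exact hX x (le_trans (le_max_left _ _) hx)

/-- Three-way splitting of a sum according to the position of `f i` relative to `a ≤ b`.
[folklore] -/
theorem sum_split_three {ι : Type*} [DecidableEq ι] (s : Finset ι) (f : ι → ℝ) (F : ι → ℝ)
    {a b : ℝ} (hab : a ≤ b) :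
    ∑ i ∈ s, F i = ∑ i ∈ s.filter (fun i => f i ≤ a), F i +
      ∑ i ∈ s.filter (fun i => a < f i ∧ f i ≤ b), F i +
        ∑ i ∈ s.filter (fun i => b < f i), F i := by
  rw [← Finset.sum_filter_add_sum_filter_not s (fun i => f i ≤ a),
    ← Finset.sum_filter_add_sum_filter_not (s.filter fun i => ¬f i ≤ a) (fun i => f i ≤ b),
    Finset.filter_filter, Finset.filter_filter, add_assoc]
  congr 2
  · refine Finset.sum_congr ?_ fun _ _ => rfl
    ext i; simp [not_le]
  · refine Finset.sum_congr ?_ fun _ _ => rfl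
    ext i
    simp only [Finset.mem_filter, not_le]
    constructor
    · rintro ⟨hi, -, h2⟩; exact ⟨hi, h2⟩
    · rintro ⟨hi, h2⟩; exact ⟨hi, lt_of_le_of_lt hab h2, h2⟩

/-- The numerical bookkeeping at the end of the proof of `exists_primeLogSum_approx_Icc`
(`P = (log x)^A`, `N` pieces, `δ' = (b - a)/N`, `E` the prime number theorem error).
[folklore] -/
theorem primeLogSum_bookkeeping {K M L P N δ' E C xb xa θb θa : ℝ} (hK : 0 ≤ K) (hM : 0 ≤ M)
    (hL : 1 ≤ L) (hP : 1 ≤ P) (hNP : N ≤ 2 * P) (hδP : δ' * P ≤ 1)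
    (hC : 0 ≤ C) (hE : E * P ^ 2 = C * xb) (hE0 : 0 ≤ E) (hxb : 0 ≤ xb)
    (hθb : θb ≤ Real.log 4 * xb) (hθa : 0 ≤ θa) (hxa : 0 ≤ xa) (hθab : θa ≤ θb) (hxab : xa ≤ xb)
    (hLP : L * P ^ 2 ≤ xb) :
    M * L + (N * (2 * M * E + 2 * M * L) + K * δ' * ((θb + xb) - (θa + xa))) ≤
      (4 * C + 6 + Real.log 4) * (K + M) * xb / P := by
  have hP0 : 0 < P := by linarith
  have hlog4 : 0 < Real.log 4 := Real.log_pos (by norm_num)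
  rw [le_div_iff₀ hP0]
  -- term 1: `K δ' (…) P ≤ K (log 4 + 1) xb`
  have h1 : K * δ' * ((θb + xb) - (θa + xa)) * P ≤ K * (Real.log 4 + 1) * xb := by
    have hΔ : (θb + xb) - (θa + xa) ≤ (Real.log 4 + 1) * xb := by nlinarith
    have hΔ0 : 0 ≤ (θb + xb) - (θa + xa) := by linarith
    calc K * δ' * ((θb + xb) - (θa + xa)) * P = K * (δ' * P) * ((θb + xb) - (θa + xa)) := by ring
      _ ≤ K * 1 * ((Real.log 4 + 1) * xb) :=
          mul_le_mul (mul_le_mul_of_nonneg_left hδP hK) hΔ hΔ0 (by positivity)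
      _ = K * (Real.log 4 + 1) * xb := by ring
  -- term 2: `N 2 M E P ≤ 4 M C xb`
  have h2 : N * (2 * M * E) * P ≤ 4 * M * C * xb := by
    have : N * (2 * M * E) * P ≤ 2 * P * (2 * M * E) * P :=
      mul_le_mul_of_nonneg_right (mul_le_mul_of_nonneg_right hNP (by positivity)) hP0.le
    calc N * (2 * M * E) * P ≤ 2 * P * (2 * M * E) * P := this
      _ = 4 * M * (E * P ^ 2) := by ring
      _ = 4 * M * C * xb := by rw [hE]; ring
  -- term 3: `(M L + 2 N M L) P ≤ 5 M xb`
  have h3 : (M * L + N * (2 * M * L)) * P ≤ 5 * M * xb := by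
    have hML : 0 ≤ M * L := mul_nonneg hM (by linarith)
    calc (M * L + N * (2 * M * L)) * P = M * L * P * (1 + 2 * N) := by ring
      _ ≤ M * L * P * (5 * P) := by
          refine mul_le_mul_of_nonneg_left ?_ (by positivity); linarith
      _ = 5 * M * (L * P ^ 2) := by ring
      _ ≤ 5 * M * xb := mul_le_mul_of_nonneg_left hLP (by positivity)
  have hid : (M * L + (N * (2 * M * E + 2 * M * L) + K * δ' * ((θb + xb) - (θa + xa)))) * P =
      (M * L + N * (2 * M * L)) * P + N * (2 * M * E) * P +
        K * δ' * ((θb + xb) - (θa + xa)) * P := by ring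
  rw [hid]
  have hid2 : (4 * C + 6 + Real.log 4) * (K + M) * xb =
      (5 * M * xb + 4 * M * C * xb + K * (Real.log 4 + 1) * xb) +
        (4 * C * K * xb + 5 * K * xb + M * xb + Real.log 4 * M * xb) := by ring
  rw [hid2]
  have hrest : 0 ≤ 4 * C * K * xb + 5 * K * xb + M * xb + Real.log 4 * M * xb := by positivity
  linarith

/-- **`ϑ`-weighted prime sums against Lipschitz test functions** (explicit-interval form). For
`0 < η' ≤ 1` and `A ∈ ℕ` there are `C, X` such that for `x ≥ X`, every set `I` with
`(a, b) ⊆ I ⊆ [a, b]`, `η' ≤ a ≤ b ≤ 1`, `I ≠ ∅`, and every measurable `φ` that is `K`-Lipschitz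
on `I`, bounded by `M` and zero outside `I`:
`|∑_{q ≤ x} (log q) φ(log q/log x) − (log x) ∫ φ(y) x^y dy| ≤ C (K + M) x^b/(log x)^A`.
[cite: FordMaynard2024PrimeSieves, Lemma 5.11] -/
theorem exists_primeLogSum_approx_Icc (η' : ℝ) (hη' : 0 < η') (A : ℕ) :
    ∃ C : ℝ, 0 ≤ C ∧ ∃ X : ℝ, 2 ≤ X ∧ ∀ x : ℝ, X ≤ x →
      ∀ (I : Set ℝ) (φ : ℝ → ℝ) (K M a b : ℝ), η' ≤ a → a ≤ b → b ≤ 1 → I.Nonempty →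
        (∀ y ∈ I, a ≤ y ∧ y ≤ b) → (∀ y, a < y → y < b → y ∈ I) → 0 ≤ K → 0 ≤ M →
        Measurable φ → (∀ y ∈ I, ∀ y' ∈ I, |φ y - φ y'| ≤ K * |y - y'|) →
        (∀ y, |φ y| ≤ M) → (∀ y, y ∉ I → φ y = 0) →
        |(∑ q ∈ Nat.primesLE ⌊x⌋₊, Real.log q * φ (Real.log q / Real.log x)) -
            Real.log x * ∫ y, φ y * x ^ y| ≤ C * (K + M) * x ^ b / Real.log x ^ A := by
  obtain ⟨C₂, hC₂0, hC₂⟩ := exists_abs_theta_sub_le_pow (2 * A)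
  obtain ⟨X, hX2, hX⟩ := eventually_largeX η' hη' A
  refine ⟨4 * C₂ / η' ^ (2 * A) + 6 + Real.log 4,
    add_nonneg (add_nonneg (by positivity) (by norm_num)) (Real.log_nonneg (by norm_num)), X, hX2, ?_⟩
  intro x hx I φ K M a b hη'a hab hb1 hne hIsub hIab hK hM hφm hlip hbd hzero
  obtain ⟨hx3, hxη, hlogpow⟩ := hX x hx
  have hx1 : 1 < x := by linarith
  have hx0 : 0 < x := by linarith
  have hL1 : 1 ≤ Real.log x := by
    rw [← Real.log_exp 1]
    exact Real.log_le_log (Real.exp_pos 1) (by linarith [Real.exp_one_lt_d9])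
  have hL0 : 0 < Real.log x := by linarith
  set L : ℝ := Real.log x with hL
  -- the bound `E` for `|ϑ(x^u) - x^u|` on `[a, b]`
  set E : ℝ := C₂ * x ^ b / (η' * L) ^ (2 * A) with hEdef
  have hηL : 0 < η' * L := mul_pos hη' hL0
  have hE : ∀ u, a ≤ u → u ≤ b → |θ (x ^ u) - x ^ u| ≤ E := by
    intro u hau hub
    have hu : η' ≤ u := hη'a.trans hau
    have hxu2 : 2 ≤ x ^ u := hxη.trans (Real.rpow_le_rpow_of_exponent_le hx1.le hu)
    refine (hC₂ (x ^ u) hxu2).trans ?_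
    rw [Real.log_rpow hx0, hEdef]
    have h1 : (η' * L) ^ (2 * A) ≤ (u * L) ^ (2 * A) :=
      pow_le_pow_left₀ hηL.le (mul_le_mul_of_nonneg_right hu hL0.le) _
    have huL : 0 ≤ (u * L) ^ (2 * A) := pow_nonneg (mul_nonneg (hη'.le.trans hu) hL0.le) _
    calc C₂ * x ^ u / (u * L) ^ (2 * A) ≤ C₂ * x ^ b / (u * L) ^ (2 * A) :=
          div_le_div_of_nonneg_right (mul_le_mul_of_nonneg_left
            (Real.rpow_le_rpow_of_exponent_le hx1.le hub) hC₂0) huL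
      _ ≤ C₂ * x ^ b / (η' * L) ^ (2 * A) :=
          div_le_div_of_nonneg_left (mul_nonneg hC₂0 (Real.rpow_nonneg hx0.le _))
            (pow_pos hηL _) h1
  -- the number of pieces
  set N : ℕ := ⌊L ^ A⌋₊ + 1 with hNdef
  have hN1 : 1 ≤ N := Nat.le_add_left 1 _
  have hNpos : (0 : ℝ) < N := by exact_mod_cast hN1
  have hNgt : L ^ A < N := by rw [hNdef]; push_cast; exact Nat.lt_floor_add_one _
  have hNle : (N : ℝ) ≤ 2 * L ^ A := by
    rw [hNdef]; push_cast
    have : (⌊L ^ A⌋₊ : ℝ) ≤ L ^ A := Nat.floor_le (by positivity)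
    have : 1 ≤ L ^ A := one_le_pow₀ hL1
    linarith
  -- the pieces estimate with `n = N`
  have hmain := primeLogSum_pieces_approx hx1 hK hM hφm hlip hbd hab hb1 hne hIsub hIab hE hN1 N
    le_rfl
  have hNδ : a + N * ((b - a) / N) = b := by field_simp; ring
  rw [hNδ] at hmain
  -- the full sum: primes with `y_q ≤ a` or `y_q > b`
  have hsplit := sum_split_three (Nat.primesLE ⌊x⌋₊) (fun q : ℕ => Real.log q / L)
    (fun q : ℕ => Real.log q * φ (Real.log q / L)) hab
  have hlow : |∑ q ∈ (Nat.primesLE ⌊x⌋₊).filter (fun q : ℕ => Real.log q / L ≤ a),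
      Real.log q * φ (Real.log q / L)| ≤ M * L := by
    set s := (Nat.primesLE ⌊x⌋₊).filter (fun q : ℕ => Real.log q / L ≤ a) with hs
    have hterm : ∀ q ∈ s, |Real.log q * φ (Real.log q / L)| ≤
        M * (if Real.log q / L = a then Real.log q else 0) := by
      intro q hq
      rw [hs, Finset.mem_filter, Nat.mem_primesLE] at hq
      have hlq : 0 ≤ Real.log q := Real.log_nonneg (by exact_mod_cast hq.1.2.one_lt.le)
      split_ifs with h
      · rw [abs_mul, abs_of_nonneg hlq, mul_comm]
        exact mul_le_mul_of_nonneg_right (hbd _) hlq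
      · have hnot : Real.log q / L ∉ I := by
          intro hin
          exact h (le_antisymm hq.2 (hIsub _ hin).1)
        rw [hzero _ hnot, mul_zero, abs_zero, mul_zero]
    calc |∑ q ∈ s, Real.log q * φ (Real.log q / L)|
        ≤ ∑ q ∈ s, |Real.log q * φ (Real.log q / L)| := Finset.abs_sum_le_sum_abs _ _
      _ ≤ ∑ q ∈ s, M * (if Real.log q / L = a then Real.log q else 0) := Finset.sum_le_sum hterm
      _ = M * ∑ q ∈ s, (if Real.log q / L = a then Real.log q else 0) := (Finset.mul_sum _ _ _).symm
      _ = M * ∑ q ∈ s.filter (fun q : ℕ => Real.log q / L = a), Real.log q :=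
          congrArg (M * ·) (Finset.sum_filter _ _).symm
      _ ≤ M * L := mul_le_mul_of_nonneg_left
          (sum_log_filter_eq_le hx1 a s (Finset.filter_subset _ _)) hM
  have hhigh : ∑ q ∈ (Nat.primesLE ⌊x⌋₊).filter (fun q : ℕ => b < Real.log q / L),
      Real.log q * φ (Real.log q / L) = 0 := by
    refine Finset.sum_eq_zero fun q hq => ?_
    rw [Finset.mem_filter] at hq
    have hnot : Real.log q / L ∉ I := fun hin => absurd (hIsub _ hin).2 (not_le.2 hq.2)
    rw [hzero _ hnot, mul_zero]
  -- the integral lives on `(a, b]`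
  have hint : ∫ y, φ y * x ^ y = ∫ y in a..b, φ y * x ^ y := by
    have hsupp : ∀ y, y ∉ Set.Icc a b → φ y * x ^ y = 0 := by
      intro y hy
      have hnot : y ∉ I := fun hin => hy ⟨(hIsub y hin).1, (hIsub y hin).2⟩
      rw [hzero y hnot, zero_mul]
    rw [← setIntegral_eq_integral_of_forall_compl_eq_zero hsupp, integral_Icc_eq_integral_Ioc,
      intervalIntegral.integral_of_le hab]
  -- assembling
  have htheta : θ (x ^ b) ≤ Real.log 4 * x ^ b :=
    Chebyshev.theta_le_log4_mul_x (Real.rpow_nonneg hx0.le b)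
  have hxb : x ^ a ≤ x ^ b := Real.rpow_le_rpow_of_exponent_le hx1.le hab
  have hxηb : x ^ η' ≤ x ^ b := Real.rpow_le_rpow_of_exponent_le hx1.le (hη'a.trans hab)
  have hxb0 : 0 < x ^ b := Real.rpow_pos_of_pos hx0 b
  have hθa : 0 ≤ θ (x ^ a) := Chebyshev.theta_nonneg _
  have hxa0 : 0 ≤ x ^ a := Real.rpow_nonneg hx0.le a
  have hδle : (b - a) / N ≤ 1 / L ^ A := by
    rw [div_le_div_iff₀ hNpos (by positivity)]
    nlinarith [hNgt, sub_nonneg.2 hab, hη'a]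
  have hLA : 0 < L ^ A := by positivity
  have hlog4 : 0 < Real.log 4 := Real.log_pos (by norm_num)
  rw [hsplit, hhigh, add_zero, hint]
  -- |low + main - L∫| ≤ |low| + |main - L∫|
  have step1 : |(∑ q ∈ (Nat.primesLE ⌊x⌋₊).filter (fun q : ℕ => Real.log q / L ≤ a),
        Real.log q * φ (Real.log q / L)) +
      (∑ q ∈ (Nat.primesLE ⌊x⌋₊).filter
          (fun q : ℕ => a < Real.log q / L ∧ Real.log q / L ≤ b),
          Real.log q * φ (Real.log q / L)) - L * ∫ y in a..b, φ y * x ^ y| ≤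
      M * L + (N * (2 * M * E + 2 * M * L) +
        K * ((b - a) / N) * ((θ (x ^ b) + x ^ b) - (θ (x ^ a) + x ^ a))) := by
    refine le_trans ?_ (add_le_add hlow hmain)
    rw [add_sub_assoc]
    exact abs_add_le _ _
  refine step1.trans ?_
  -- the final numerical bookkeeping
  have hP1 : 1 ≤ L ^ A := one_le_pow₀ hL1
  have hδP : (b - a) / N * L ^ A ≤ 1 := by
    rw [div_mul_eq_mul_div, div_le_one hNpos]; nlinarith [sub_nonneg.2 hab]
  have hEeq : E * (L ^ A) ^ 2 = C₂ / η' ^ (2 * A) * x ^ b := by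
    rw [hEdef, mul_pow, show L ^ (2 * A) = (L ^ A) ^ 2 by rw [← pow_mul, mul_comm]]
    field_simp
  have hE0 : 0 ≤ E := by rw [hEdef]; positivity
  have hLP : L * (L ^ A) ^ 2 ≤ x ^ b := by
    calc L * (L ^ A) ^ 2 = L ^ (2 * A + 1) := by ring
      _ ≤ x ^ b := hlogpow.trans hxηb
  rw [show 4 * C₂ / η' ^ (2 * A) = 4 * (C₂ / η' ^ (2 * A)) by ring]
  exact primeLogSum_bookkeeping hK hM hL1 hP1 hNle hδP (by positivity) hEeq hE0
    hxb0.le htheta hθa hxa0 (Chebyshev.theta_mono hxb) hxb hLP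

/-! ### The unweighted comparison (main export) -/

/-- **Prime sums against Lipschitz test functions, one variable.** For `0 < η' ≤ 1` and `A ∈ ℕ`
there are `C ≥ 0` and `X ≥ 2` such that for all `x ≥ X`: whenever `I ⊆ [η', 1]` is an interval
(`OrdConnected`) bounded above by `b`, and `φ : ℝ → ℝ` is measurable, `K`-Lipschitz on `I`,
bounded by `M` and zero outside `I`, then
`|∑_{q ≤ x prime} φ(log q / log x) − ∫ φ(y) x^y dy/y| ≤ C (K + M) x^b / (log x)^A`.
This is Ford–Maynard's Lemma 5.11 for one prime variable (and a log-power error term).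
[cite: FordMaynard2024PrimeSieves, Lemma 5.11] -/
theorem exists_primeSum_approx (η' : ℝ) (hη' : 0 < η') (hη'1 : η' ≤ 1) (A : ℕ) :
    ∃ C : ℝ, 0 ≤ C ∧ ∃ X : ℝ, 2 ≤ X ∧ ∀ x : ℝ, X ≤ x →
      ∀ (I : Set ℝ) (φ : ℝ → ℝ) (K M b : ℝ), I.OrdConnected → I ⊆ Set.Icc η' 1 →
        (∀ y ∈ I, y ≤ b) → 0 ≤ K → 0 ≤ M → Measurable φ →
        (∀ y ∈ I, ∀ y' ∈ I, |φ y - φ y'| ≤ K * |y - y'|) → (∀ y, |φ y| ≤ M) →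
        (∀ y, y ∉ I → φ y = 0) →
        |(∑ q ∈ Nat.primesLE ⌊x⌋₊, φ (Real.log q / Real.log x)) -
            ∫ y, φ y * (x ^ y / y)| ≤ C * (K + M) * x ^ b / Real.log x ^ A := by
  obtain ⟨C, hC0, X, hX2, hθ⟩ := exists_primeLogSum_approx_Icc η' hη' A
  refine ⟨2 * C / η' ^ 2, by positivity, max X 3, le_trans hX2 (le_max_left _ _), ?_⟩
  intro x hx I φ K M b hI hIsub hb hK hM hφm hlip hbd hzero
  have hxX : X ≤ x := le_trans (le_max_left _ _) hx
  have hx3 : 3 ≤ x := le_trans (le_max_right _ _) hx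
  have hx1 : 1 < x := by linarith
  have hx0 : 0 < x := by linarith
  have hL1 : 1 ≤ Real.log x := by
    rw [← Real.log_exp 1]
    exact Real.log_le_log (Real.exp_pos 1) (by linarith [Real.exp_one_lt_d9])
  have hL0 : 0 < Real.log x := by linarith
  set L : ℝ := Real.log x with hL
  have hLA : 0 < L ^ A := pow_pos hL0 A
  by_cases hne : I.Nonempty
  swap
  · -- empty `I`: everything vanishes
    have hφ0 : ∀ y, φ y = 0 := fun y => hzero y (fun hy => hne ⟨y, hy⟩)
    simp only [hφ0, Finset.sum_const_zero, zero_mul, integral_zero, sub_zero, abs_zero]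
    positivity
  -- `a = inf I`, `b₀ = sup I`
  have hbdd1 : BddBelow I := ⟨η', fun y hy => (hIsub hy).1⟩
  have hbdd2 : BddAbove I := ⟨1, fun y hy => (hIsub hy).2⟩
  set a : ℝ := sInf I with ha
  set b₀ : ℝ := sSup I with hb₀
  have haI : ∀ y ∈ I, a ≤ y := fun y hy => csInf_le hbdd1 hy
  have hbI : ∀ y ∈ I, y ≤ b₀ := fun y hy => le_csSup hbdd2 hy
  have hη'a : η' ≤ a := le_csInf hne fun y hy => (hIsub hy).1
  have hb₀1 : b₀ ≤ 1 := csSup_le hne fun y hy => (hIsub hy).2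
  have hb₀b : b₀ ≤ b := csSup_le hne hb
  have hab : a ≤ b₀ := by
    obtain ⟨y, hy⟩ := hne; exact (haI y hy).trans (hbI y hy)
  have hIoo : ∀ y, a < y → y < b₀ → y ∈ I := by
    intro y hay hyb
    obtain ⟨i, hi, hiy⟩ := exists_lt_of_csInf_lt hne hay
    obtain ⟨i', hi', hyi'⟩ := exists_lt_of_lt_csSup hne hyb
    exact hI.out hi hi' ⟨hiy.le, hyi'.le⟩
  have ha0 : 0 < a := lt_of_lt_of_le hη' hη'a
  -- the rescaled test function `gψ(y) = φ(y)/(y log x)`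
  set gψ : ℝ → ℝ := fun y => φ y / (y * L) with hg
  have hgm : Measurable gψ := hφm.div (measurable_id.mul measurable_const)
  have hgzero : ∀ y, y ∉ I → gψ y = 0 := fun y hy => by
    show φ y / (y * L) = 0
    rw [hzero y hy, zero_div]
  have hyI : ∀ y ∈ I, η' ≤ y := fun y hy => (hIsub hy).1
  have hgbd : ∀ y, |gψ y| ≤ M / (η' * L) := by
    intro y
    by_cases hy : y ∈ I
    · have hy0 : 0 < y := lt_of_lt_of_le hη' (hyI y hy)
      show |φ y / (y * L)| ≤ M / (η' * L)
      rw [abs_div, abs_of_pos (mul_pos hy0 hL0)]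
      exact div_le_div₀ hM (hbd y) (mul_pos hη' hL0)
        (mul_le_mul_of_nonneg_right (hyI y hy) hL0.le)
    · rw [hgzero y hy, abs_zero]; positivity
  have hglip : ∀ y ∈ I, ∀ y' ∈ I, |gψ y - gψ y'| ≤ (K / η' + M / η' ^ 2) / L * |y - y'| := by
    intro y hy y' hy'
    have hy0 : 0 < y := lt_of_lt_of_le hη' (hyI y hy)
    have hy0' : 0 < y' := lt_of_lt_of_le hη' (hyI y' hy')
    show |φ y / (y * L) - φ y' / (y' * L)| ≤ (K / η' + M / η' ^ 2) / L * |y - y'|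
    have hsplit : φ y / (y * L) - φ y' / (y' * L) =
        ((φ y - φ y') / y + φ y' * ((y' - y) / (y * y'))) / L := by
      field_simp; ring
    rw [hsplit, abs_div, abs_of_pos hL0, div_mul_eq_mul_div]
    refine div_le_div_of_nonneg_right ?_ hL0.le
    refine (abs_add_le _ _).trans ?_
    rw [abs_div, abs_of_pos hy0, abs_mul, abs_div, abs_of_pos (mul_pos hy0 hy0'), abs_sub_comm y' y]
    have h1 : |φ y - φ y'| / y ≤ K / η' * |y - y'| := by
      rw [div_le_iff₀ hy0]
      calc |φ y - φ y'| ≤ K * |y - y'| := hlip y hy y' hy'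
        _ = K / η' * |y - y'| * η' := by field_simp
        _ ≤ K / η' * |y - y'| * y :=
            mul_le_mul_of_nonneg_left (hyI y hy) (by positivity)
    have h2 : |φ y'| * (|y - y'| / (y * y')) ≤ M / η' ^ 2 * |y - y'| := by
      have hyy : η' ^ 2 ≤ y * y' := by
        rw [sq]; exact mul_le_mul (hyI y hy) (hyI y' hy') hη'.le hy0.le
      calc |φ y'| * (|y - y'| / (y * y')) ≤ M * (|y - y'| / η' ^ 2) :=
            mul_le_mul (hbd y') (div_le_div_of_nonneg_left (abs_nonneg _) (by positivity) hyy)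
              (by positivity) hM
        _ = M / η' ^ 2 * |y - y'| := by ring
    calc |φ y - φ y'| / y + |φ y'| * (|y - y'| / (y * y'))
        ≤ K / η' * |y - y'| + M / η' ^ 2 * |y - y'| := add_le_add h1 h2
      _ = (K / η' + M / η' ^ 2) * |y - y'| := by ring
  -- apply the `ϑ`-weighted comparison to `gψ`
  have hmain := hθ x hxX I gψ ((K / η' + M / η' ^ 2) / L) (M / (η' * L)) a b₀ hη'a hab hb₀1 hne
    (fun y hy => ⟨haI y hy, hbI y hy⟩) hIoo (by positivity) (by positivity) hgm hglip hgbd hgzero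
  -- identify the two sides
  have hsum : (∑ q ∈ Nat.primesLE ⌊x⌋₊, Real.log q * gψ (Real.log q / L)) =
      ∑ q ∈ Nat.primesLE ⌊x⌋₊, φ (Real.log q / L) := by
    refine Finset.sum_congr rfl fun q hq => ?_
    rw [Nat.mem_primesLE] at hq
    have hlq : 0 < Real.log q := Real.log_pos (by exact_mod_cast hq.2.one_lt)
    show Real.log q * (φ (Real.log q / L) / (Real.log q / L * L)) = φ (Real.log q / L)
    field_simp
  have hint : L * ∫ y, gψ y * x ^ y = ∫ y, φ y * (x ^ y / y) := by
    rw [← integral_const_mul]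
    refine integral_congr_ae (Filter.Eventually.of_forall fun y => ?_)
    show L * (φ y / (y * L) * x ^ y) = φ y * (x ^ y / y)
    by_cases hy : y = 0
    · simp [hy]
    · field_simp
  rw [hsum, hint] at hmain
  refine hmain.trans ?_
  -- compare the constants
  have hcoef : (K / η' + M / η' ^ 2) / L + M / (η' * L) ≤ 2 / η' ^ 2 * (K + M) := by
    have hη2 : 0 < η' ^ 2 := by positivity
    have h1 : (K / η' + M / η' ^ 2) / L ≤ K / η' + M / η' ^ 2 :=
      div_le_self (by positivity) hL1
    have h2 : M / (η' * L) ≤ M / η' := by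
      apply div_le_div_of_nonneg_left hM hη'
      calc η' = η' * 1 := (mul_one _).symm
        _ ≤ η' * L := mul_le_mul_of_nonneg_left hL1 hη'.le
    have h3 : K / η' ≤ K / η' ^ 2 :=
      div_le_div_of_nonneg_left hK hη2 (by nlinarith)
    have h4 : M / η' ≤ M / η' ^ 2 :=
      div_le_div_of_nonneg_left hM hη2 (by nlinarith)
    calc (K / η' + M / η' ^ 2) / L + M / (η' * L) ≤ K / η' ^ 2 + M / η' ^ 2 + M / η' ^ 2 := by
          linarith
      _ ≤ 2 / η' ^ 2 * (K + M) := by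
          rw [show K / η' ^ 2 + M / η' ^ 2 + M / η' ^ 2 = (K + 2 * M) / η' ^ 2 by ring,
            div_le_iff₀ hη2]
          rw [show 2 / η' ^ 2 * (K + M) * η' ^ 2 = 2 * (K + M) by field_simp]
          linarith
  have hxb : x ^ b₀ ≤ x ^ b := Real.rpow_le_rpow_of_exponent_le hx1.le hb₀b
  calc C * ((K / η' + M / η' ^ 2) / L + M / (η' * L)) * x ^ b₀ / L ^ A
      ≤ C * (2 / η' ^ 2 * (K + M)) * x ^ b / L ^ A := by
        refine div_le_div_of_nonneg_right ?_ hLA.le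
        exact mul_le_mul (mul_le_mul_of_nonneg_left hcoef hC0) hxb (Real.rpow_nonneg hx0.le _)
          (by positivity)
    _ = 2 * C / η' ^ 2 * (K + M) * x ^ b / L ^ A := by ring

end Literature.NumberTheory.Sieve.FordMaynard
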